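import Literature.Analysis.FluidPDE.NormalisedPressureLpBound
import Literature.Analysis.FluidPDE.NormalisedPressureL2Bound
import Literature.Analysis.FluidPDE.NewtonPotentialHolder
import Literature.Analysis.SingularIntegrals.CalderonZygmundLp
import HarnessLib

/-!
# The `L^p` bound for the normalised pressure: discharge of `stein1970_normalisedPressure_Lp_bound`

Analysis/FluidPDE proof file; sibling of `NormalisedPressureLpBound` (the named fact
`Literature.Analysis.FluidPDE.stein1970_normalisedPressure_Lp_bound`, Stein 1970, Ch. II §4.2
Theorem 3 for the nine Riesz-type kernels of the normalised pressure) and of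
`NormalisedPressureL2Bound` (the case `p = 2`, proved by the Newtonian-potential route). This
file PROVES the fact for every `1 < p < ∞` (`stein1970_normalisedPressure_Lp_bound_holds`) by
genuine Calderón–Zygmund theory, vendored (and proved) for this purpose in
`Literature/Analysis/SingularIntegrals/` (Marcinkiewicz interpolation, the Calderón–Zygmund
decomposition, the weak type `(1,1)` estimate under Hörmander's condition, density and duality:
Stein 1970, Ch. I §3–§4 and Ch. II §2–§3).

## The argument

The `L²` file realises `p̃[w]` (`w ∈ C^∞_c`) as the pointwise limit of the regularised
pressures `Q_ε[w] = -∫ D²Φ_ε(x-y)(w(y),w(y)) dy` (`regPressure`, `Φ_ε = newtonReg ε` the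
regularised Newtonian kernel), and `Q_ε[w]` as the polarisation combination of the 27 Hessian
convolutions `H^a_ε[wᵢwⱼ] = ∫ wᵢwⱼ(t) ∂ₐ∂ₐΦ_ε(· - t) dt` (`hessConv`) with
`‖H^a_ε[h]‖₂ ≤ |a|² M_λ ‖h‖₂` (`eLpNorm_hessConv_le`). Here:

* §1 the kernels `k^a_ε = ∂ₐ∂ₐΦ_ε` are bounded (`ε⁻³M|a|²`), equal to `-K(·)(a)` off `B̄_ε`
  (tree), and satisfy **Hörmander's condition uniformly in `ε` and `|a| ≤ 2`**
  (`exists_hormander_bound_hessKernel`): off `B_{2ε}` by the `z`-regularity of the pressure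
  kernel `|K(x-y)(a) - K(x)(a)| ≤ 16 M₃ |a|²|y|/|x|⁴` for `|x| ≥ 2|y|`
  (`abs_pressureKernel_sub_pressureKernel_le`, mean value theorem with `‖D³Γ(z)‖ ≤ M₃/|z|⁴` from the
  homogeneity of `D³Γ`, `NewtonKernel`) and `∫_{|x|≥2|y|} |x|⁻⁴ = 2π/|y|`
  (`NewtonPotentialHolder.lintegral_compl_ball_norm_rpow_neg`); on `B_{2ε}` by the sup bound;
* §2 hence the uniform Calderón–Zygmund theorem
  (`SingularIntegrals.exists_eLpNorm_le`, `n = 3`, `A = 4M_λ`, `B` the Hörmander bound) gives ONE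
  constant `C_p` with `‖H^a_ε[h]‖_p ≤ C_p ‖h‖_p` for all `ε > 0`, `|a| ≤ 2`, `h ∈ C_c`
  (`exists_eLpNorm_hessConv_le`);
* §3 polarisation as in the `L²` file: `‖Q_ε[w]‖_p ≤ 27 C_p ‖|w|²‖_p`
  (`exists_eLpNorm_regPressure_le`), and Fatou along `ε = 1/(n+1)` (`p̃[w] = lim Q_ε[w]`
  pointwise, `normalisedPressure_eq_limPressure`, `tendsto_regPressure_nat`).

## References

* E. M. Stein, *Singular integrals and differentiability properties of functions*, Princeton
  Math. Series 30 (1970): Ch. II §4.2 Theorem 3 (and §3.2 Theorem 2, §3.1 Corollary, §2.5, Ch. I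
  §3–§4 for the proof). [`Stein1971`]
* T. Tao, *Localisation and compactness properties of the Navier–Stokes global regularity
  problem*, Anal. PDE 6 (2013) = arXiv:1108.1165, (35). [`Tao2011`]
-/

noncomputable section

open MeasureTheory Set Filter Topology Function Metric
open scoped ENNReal NNReal RealInnerProductSpace ContDiff

namespace Literature.Analysis.FluidPDE

-- nested operator types `ℝ³ →L[ℝ] ℝ³ →L[ℝ] ℝ³ →L[ℝ] ℝ` (third derivatives)
set_option maxSynthPendingDepth 3

/-! ## §1. `z`-regularity of the pressure kernel and Hörmander's condition -/

section KernelRegularity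

/-- **Decay of `D³Γ`:** `‖D³Γ(z)‖ ≤ M₃/|z|⁴` for `z ≠ 0` (`D³Γ` is homogeneous of degree `-4`
and continuous off the origin, `NewtonKernel`). [folklore] -/
theorem exists_bound_fderiv3_newtonKernel :
    ∃ M₃ : ℝ, 0 ≤ M₃ ∧ ∀ z : (EuclideanSpace ℝ (Fin 3)), z ≠ 0 →
      ‖fderiv ℝ (fderiv ℝ (fderiv ℝ newtonKernel)) z‖ ≤ M₃ / ‖z‖ ^ 4 := by
  obtain ⟨M, hM⟩ := exists_bound_of_homogeneous (fderiv ℝ (fderiv ℝ (fderiv ℝ newtonKernel)))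
    (-4) (by norm_num) fderiv3_newtonKernel_homogeneous
    (contDiffOn_fderiv3_newtonKernel (n := 0)).continuousOn one_pos
  refine ⟨max M 0, le_max_right _ _, fun z hz => ?_⟩
  have hz' : 0 < ‖z‖ := norm_pos_iff.2 hz
  set u : (EuclideanSpace ℝ (Fin 3)) := ‖z‖⁻¹ • z with hu_def
  have hu : ‖u‖ = 1 := by
    rw [hu_def, norm_smul, norm_inv, norm_norm, inv_mul_cancel₀ hz'.ne']
  have hzu : ‖z‖ • u = z := by rw [hu_def, smul_smul, mul_inv_cancel₀ hz'.ne', one_smul]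
  have h := fderiv3_newtonKernel_homogeneous ‖z‖ hz' u
  rw [hzu] at h
  rw [h, norm_smul, norm_zpow, Real.norm_eq_abs, abs_of_pos hz',
    show (-4 : ℤ) = -((4 : ℕ) : ℤ) by norm_num, zpow_neg, zpow_natCast, div_eq_inv_mul]
  gcongr
  exact (hM u (by rw [hu])).trans (le_max_left _ _)

/-- **`z`-regularity of the pressure kernel** (the hypothesis `|∇K| ≤ B|x|⁻ⁿ⁻¹` of Stein 1970,
Ch. II §2.2 (2) in integrated form): for `|x| ≥ 2|y|`, `x ≠ 0`,
`|K(x-y)(a) - K(x)(a)| ≤ 16 M₃ |a|² |y| / |x|⁴` (mean value theorem on `B̄(x, |y|)`, where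
`|w| ≥ |x|/2`, with `K(w)(a) = -D²Γ(w)(a,a)` and `‖D³Γ(w)‖ ≤ M₃/|w|⁴`). [cite: Stein1971, Ch. II §2.2 (2)] -/
theorem abs_pressureKernel_sub_pressureKernel_le {M₃ : ℝ} (hM₃0 : 0 ≤ M₃)
    (hM₃ : ∀ z : (EuclideanSpace ℝ (Fin 3)), z ≠ 0 → ‖fderiv ℝ (fderiv ℝ (fderiv ℝ newtonKernel)) z‖ ≤ M₃ / ‖z‖ ^ 4)
    (a : (EuclideanSpace ℝ (Fin 3))) {x y : (EuclideanSpace ℝ (Fin 3))} (hx : x ≠ 0) (hxy : 2 * ‖y‖ ≤ ‖x‖) :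
    |pressureKernel (x - y) a - pressureKernel x a| ≤ 16 * M₃ * ‖a‖ ^ 2 * ‖y‖ / ‖x‖ ^ 4 := by
  have hx' : 0 < ‖x‖ := norm_pos_iff.2 hx
  set Φ₂ : (EuclideanSpace ℝ (Fin 3)) → (EuclideanSpace ℝ (Fin 3)) →L[ℝ] (EuclideanSpace ℝ (Fin 3)) →L[ℝ] ℝ := fderiv ℝ (fderiv ℝ newtonKernel) with hΦ₂
  set ψ : (EuclideanSpace ℝ (Fin 3)) → ℝ := fun w => Φ₂ w a a with hψ
  -- differentiability off the origin
  have hd1 : ∀ w : (EuclideanSpace ℝ (Fin 3)), w ≠ 0 → DifferentiableAt ℝ (fderiv ℝ newtonKernel) w := fun w hw =>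
    ((contDiffOn_fderiv_newtonKernel (n := 1)).differentiableOn one_ne_zero).differentiableAt
      (isOpen_compl_singleton.mem_nhds hw)
  have hd2 : ∀ w : (EuclideanSpace ℝ (Fin 3)), w ≠ 0 → DifferentiableAt ℝ Φ₂ w := fun w hw =>
    ((contDiffOn_fderiv2_newtonKernel (n := 1)).differentiableOn one_ne_zero).differentiableAt
      (isOpen_compl_singleton.mem_nhds hw)
  -- `ψ = -K(·)(a)` off the origin
  have hψK : ∀ w : (EuclideanSpace ℝ (Fin 3)), w ≠ 0 → ψ w = -pressureKernel w a := fun w hw => by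
    rw [← fderiv_fderiv_newtonKernel_apply_self hw a, fderiv_apply_const_apply (hd1 w hw) a a]
  -- the ball `B̄(x, |y|)` avoids the origin: `|w| ≥ |x|/2`
  have hball : ∀ w ∈ closedBall x ‖y‖, ‖x‖ / 2 ≤ ‖w‖ := by
    intro w hw
    rw [mem_closedBall, dist_eq_norm] at hw
    have := norm_sub_norm_le x w
    rw [← norm_neg (x - w), neg_sub] at this
    have h2 : ‖x‖ - ‖w‖ ≤ ‖w - x‖ := by
      have := norm_sub_norm_le x w
      rwa [norm_sub_rev] at this
    linarith
  have hball0 : ∀ w ∈ closedBall x ‖y‖, w ≠ 0 := fun w hw h0 => by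
    have := hball w hw
    rw [h0, norm_zero] at this
    linarith
  -- derivative of `ψ` and its bound on the ball
  have hψd : ∀ w ∈ closedBall x ‖y‖, DifferentiableAt ℝ ψ w := fun w hw =>
    ((hd2 w (hball0 w hw)).clm_apply (differentiableAt_const a)).clm_apply (differentiableAt_const a)
  have hψ' : ∀ w ∈ closedBall x ‖y‖, ‖fderiv ℝ ψ w‖ ≤ 16 * M₃ * ‖a‖ ^ 2 / ‖x‖ ^ 4 := by
    intro w hw
    have hw0 := hball0 w hw
    have hwx := hball w hw
    have hΦ₃ : ‖fderiv ℝ Φ₂ w‖ ≤ 16 * M₃ / ‖x‖ ^ 4 := by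
      refine (hM₃ w hw0).trans ?_
      rw [div_le_div_iff₀ (by positivity) (by positivity)]
      have h16 : ‖x‖ ^ 4 ≤ 16 * ‖w‖ ^ 4 := by
        have : ‖x‖ ≤ 2 * ‖w‖ := by linarith
        calc ‖x‖ ^ 4 ≤ (2 * ‖w‖) ^ 4 := pow_le_pow_left₀ hx'.le this 4
          _ = 16 * ‖w‖ ^ 4 := by ring
      nlinarith
    have hform : ∀ h : (EuclideanSpace ℝ (Fin 3)), fderiv ℝ ψ w h = fderiv ℝ Φ₂ w h a a := by
      intro h
      have e1 : fderiv ℝ ψ w h = fderiv ℝ (fun w => Φ₂ w a) w h a :=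
        fderiv_apply_const_apply ((hd2 w hw0).clm_apply (differentiableAt_const a)) a h
      rw [e1, fderiv_apply_const_apply (hd2 w hw0) a h]
    refine ContinuousLinearMap.opNorm_le_bound _ (by positivity) fun h => ?_
    rw [hform]
    calc ‖fderiv ℝ Φ₂ w h a a‖ ≤ ‖fderiv ℝ Φ₂ w h a‖ * ‖a‖ := ContinuousLinearMap.le_opNorm _ _
      _ ≤ ‖fderiv ℝ Φ₂ w h‖ * ‖a‖ * ‖a‖ := by gcongr; exact ContinuousLinearMap.le_opNorm _ _
      _ ≤ ‖fderiv ℝ Φ₂ w‖ * ‖h‖ * ‖a‖ * ‖a‖ := by gcongr; exact ContinuousLinearMap.le_opNorm _ _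
      _ ≤ 16 * M₃ / ‖x‖ ^ 4 * ‖h‖ * ‖a‖ * ‖a‖ := by gcongr
      _ = 16 * M₃ * ‖a‖ ^ 2 / ‖x‖ ^ 4 * ‖h‖ := by ring
  -- mean value theorem on the convex ball
  have hmv := (convex_closedBall x ‖y‖).norm_image_sub_le_of_norm_fderiv_le hψd hψ'
    (mem_closedBall_self (norm_nonneg y))
    (show x - y ∈ closedBall x ‖y‖ by rw [mem_closedBall, dist_eq_norm, sub_sub_cancel_left, norm_neg])
  rw [sub_sub_cancel_left, norm_neg, Real.norm_eq_abs, hψK _ (hball0 _ (show x - y ∈ closedBall x ‖y‖ by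
      rw [mem_closedBall, dist_eq_norm, sub_sub_cancel_left, norm_neg])),
    hψK x hx] at hmv
  rw [show pressureKernel (x - y) a - pressureKernel x a =
      -(-pressureKernel (x - y) a - -pressureKernel x a) by ring, abs_neg]
  calc |(-pressureKernel (x - y) a) - -pressureKernel x a| ≤ 16 * M₃ * ‖a‖ ^ 2 / ‖x‖ ^ 4 * ‖y‖ := hmv
    _ = 16 * M₃ * ‖a‖ ^ 2 * ‖y‖ / ‖x‖ ^ 4 := by ring

/-- The regularised Hessian kernel `k^a_ε(z) = ∂ₐ∂ₐΦ_ε(z)` is bounded by `ε⁻³ M |a|²`. [folklore] -/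
theorem abs_hessKernel_le {M : ℝ} (hM : ∀ ε : ℝ, 0 < ε → ∀ z : (EuclideanSpace ℝ (Fin 3)),
      ‖fderiv ℝ (fderiv ℝ (newtonReg ε)) z‖ ≤ ε⁻¹ ^ 3 * M) {ε : ℝ} (hε : 0 < ε) (a z : (EuclideanSpace ℝ (Fin 3))) :
    |fderiv ℝ (fun s => fderiv ℝ (newtonReg ε) s a) z a| ≤ ε⁻¹ ^ 3 * M * ‖a‖ ^ 2 := by
  rw [fderiv_fderiv_newtonReg_apply_eq_hessReg, ← Real.norm_eq_abs]
  calc ‖hessReg ε z a a‖ ≤ ‖hessReg ε z a‖ * ‖a‖ := ContinuousLinearMap.le_opNorm _ _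
    _ ≤ ‖hessReg ε z‖ * ‖a‖ * ‖a‖ := by gcongr; exact ContinuousLinearMap.le_opNorm _ _
    _ ≤ ε⁻¹ ^ 3 * M * ‖a‖ * ‖a‖ := by gcongr; exact hM ε hε z
    _ = ε⁻¹ ^ 3 * M * ‖a‖ ^ 2 := by ring

/-- The regularised Hessian kernel `k^a_ε = ∂ₐ∂ₐΦ_ε` is continuous. [folklore] -/
theorem continuous_hessKernel (ε : ℝ) (a : (EuclideanSpace ℝ (Fin 3))) :
    Continuous fun z : (EuclideanSpace ℝ (Fin 3)) => fderiv ℝ (fun s => fderiv ℝ (newtonReg ε) s a) z a :=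
  continuous_fderiv_fderiv_apply (contDiff_newtonReg ε (n := 2)) a a

/-- **Hörmander's condition for the regularised pressure kernels, uniformly in the scale**
(Stein 1970, Ch. II §3.1 (2'), verified as in §3.3–3.4: "`K_ε` satisfies the same conditions
with bounds not greater than `CB`"): there is `B` such that for all `ε > 0`, `|a| ≤ 2` and `y`,
`∫_{|x|≥2|y|} |k^a_ε(x-y) - k^a_ε(x)| dx ≤ B`, `k^a_ε = ∂ₐ∂ₐΦ_ε` (off `B_{2ε}` both points are
in the region `k^a_ε = -K(·)(a)` and the `z`-regularity of `K` integrates against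
`∫_{|x|≥2|y|}|x|⁻⁴ = 2π/|y|`; on `B_{2ε}` the sup bound `ε⁻³M|a|²` times the volume `∝ ε³`). [cite: Stein1971, Ch. II §3.4] -/
theorem exists_hormander_bound_hessKernel :
    ∃ B : ℝ≥0, ∀ ε : ℝ, 0 < ε → ∀ a : (EuclideanSpace ℝ (Fin 3)), ‖a‖ ≤ 2 → ∀ y : (EuclideanSpace ℝ (Fin 3)),
      ∫⁻ x in {x : (EuclideanSpace ℝ (Fin 3)) | 2 * ‖y‖ ≤ ‖x‖},
        ‖fderiv ℝ (fun s => fderiv ℝ (newtonReg ε) s a) (x - y) a -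
          fderiv ℝ (fun s => fderiv ℝ (newtonReg ε) s a) x a‖ₑ ≤ B := by
  obtain ⟨M, hM0, hM⟩ := exists_bound_fderiv_fderiv_newtonReg
  obtain ⟨M₃, hM₃0, hM₃⟩ := exists_bound_fderiv3_newtonKernel
  set V₁ : ℝ≥0∞ := volume (closedBall (0 : (EuclideanSpace ℝ (Fin 3))) 1) with hV₁
  have hV₁top : V₁ ≠ ⊤ := measure_closedBall_lt_top.ne
  set v₁ : ℝ := (volume : Measure (EuclideanSpace ℝ (Fin 3))).real (ball (0 : (EuclideanSpace ℝ (Fin 3))) 1) with hv₁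
  set Btot : ℝ≥0∞ := ENNReal.ofReal (64 * M) * V₁ + ENNReal.ofReal (96 * M₃ * v₁) with hBtot
  have hBtop : Btot ≠ ⊤ := ENNReal.add_ne_top.2
    ⟨ENNReal.mul_ne_top ENNReal.ofReal_ne_top hV₁top, ENNReal.ofReal_ne_top⟩
  refine ⟨Btot.toNNReal, fun ε hε a ha y => ?_⟩
  rw [ENNReal.coe_toNNReal hBtop]
  set k : (EuclideanSpace ℝ (Fin 3)) → ℝ := fun z => fderiv ℝ (fun s => fderiv ℝ (newtonReg ε) s a) z a with hk
  set S : Set (EuclideanSpace ℝ (Fin 3)) := {x : (EuclideanSpace ℝ (Fin 3)) | 2 * ‖y‖ ≤ ‖x‖} with hS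
  have hSm : MeasurableSet S := measurableSet_le measurable_const measurable_norm
  set A : Set (EuclideanSpace ℝ (Fin 3)) := closedBall (0 : (EuclideanSpace ℝ (Fin 3))) (2 * ε) with hA
  have hAm : MeasurableSet A := measurableSet_closedBall
  have ha2 : ‖a‖ ^ 2 ≤ 4 := by nlinarith [norm_nonneg a]
  -- sup bound of the kernel
  have hkb : ∀ z, |k z| ≤ ε⁻¹ ^ 3 * M * 4 := fun z =>
    (abs_hessKernel_le hM hε a z).trans (by gcongr)
  /- Part 1: near the origin -/
  have hnear : ∫⁻ x in S ∩ A, ‖k (x - y) - k x‖ₑ ≤ ENNReal.ofReal (64 * M) * V₁ := by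
    calc ∫⁻ x in S ∩ A, ‖k (x - y) - k x‖ₑ ≤ ∫⁻ x in A, ‖k (x - y) - k x‖ₑ :=
          lintegral_mono_set inter_subset_right
      _ ≤ ∫⁻ x in A, ENNReal.ofReal (2 * (ε⁻¹ ^ 3 * M * 4)) := by
          refine lintegral_mono fun x => ?_
          rw [Real.enorm_eq_ofReal_abs]
          refine ENNReal.ofReal_le_ofReal ?_
          calc |k (x - y) - k x| ≤ |k (x - y)| + |k x| := abs_sub _ _
            _ ≤ ε⁻¹ ^ 3 * M * 4 + ε⁻¹ ^ 3 * M * 4 := add_le_add (hkb _) (hkb _)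
            _ = 2 * (ε⁻¹ ^ 3 * M * 4) := by ring
      _ = ENNReal.ofReal (2 * (ε⁻¹ ^ 3 * M * 4)) * volume A := setLIntegral_const _ _
      _ = ENNReal.ofReal (2 * (ε⁻¹ ^ 3 * M * 4)) * (ENNReal.ofReal ((2 * ε) ^ 3) * V₁) := by
          rw [hA, Measure.addHaar_closedBall' volume (0 : (EuclideanSpace ℝ (Fin 3))) (by positivity : (0 : ℝ) ≤ 2 * ε),
            finrank_euclideanSpace_fin]
      _ = ENNReal.ofReal (64 * M) * V₁ := by
          rw [← mul_assoc, ← ENNReal.ofReal_mul (by positivity)]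
          congr 2
          field_simp
          ring
  /- Part 2: away from the origin both points see the pressure kernel -/
  have hfar_pt : ∀ x ∈ S ∩ Aᶜ, ‖k (x - y) - k x‖ₑ ≤ ENNReal.ofReal (64 * M₃ * ‖y‖ * ‖x‖ ^ (-(4 : ℝ))) := by
    rintro x ⟨hxS, hxA⟩
    have hxS' : 2 * ‖y‖ ≤ ‖x‖ := hxS
    rw [hA, mem_compl_iff, mem_closedBall_zero_iff, not_le] at hxA
    have hx0 : x ≠ 0 := fun h => by rw [h, norm_zero] at hxA; linarith
    have hxpos : 0 < ‖x‖ := norm_pos_iff.2 hx0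
    have hxε : ε < ‖x‖ := by linarith
    have hxyε : ε < ‖x - y‖ := by
      have : ‖x‖ - ‖y‖ ≤ ‖x - y‖ := norm_sub_norm_le x y
      linarith
    simp only [hk]
    rw [fderiv_fderiv_newtonReg_apply_eq_neg_pressureKernel hε hxyε,
      fderiv_fderiv_newtonReg_apply_eq_neg_pressureKernel hε hxε, Real.enorm_eq_ofReal_abs,
      show -pressureKernel (x - y) a - -pressureKernel x a = -(pressureKernel (x - y) a - pressureKernel x a) by ring,
      abs_neg]
    refine ENNReal.ofReal_le_ofReal ((abs_pressureKernel_sub_pressureKernel_le hM₃0 hM₃ a hx0 hxS').trans ?_)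
    rw [Real.rpow_neg hxpos.le, show (4 : ℝ) = ((4 : ℕ) : ℝ) by norm_num, Real.rpow_natCast,
      div_eq_mul_inv]
    refine mul_le_mul_of_nonneg_right ?_ (by positivity)
    calc 16 * M₃ * ‖a‖ ^ 2 * ‖y‖ ≤ 16 * M₃ * 4 * ‖y‖ := by gcongr
      _ = 64 * M₃ * ‖y‖ := by ring
  have hfar : ∫⁻ x in S ∩ Aᶜ, ‖k (x - y) - k x‖ₑ ≤ ENNReal.ofReal (96 * M₃ * v₁) := by
    rcases eq_or_ne y 0 with rfl | hy
    · simp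
    have hypos : 0 < ‖y‖ := norm_pos_iff.2 hy
    calc ∫⁻ x in S ∩ Aᶜ, ‖k (x - y) - k x‖ₑ
        ≤ ∫⁻ x in S ∩ Aᶜ, ENNReal.ofReal (64 * M₃ * ‖y‖ * ‖x‖ ^ (-(4 : ℝ))) :=
          setLIntegral_mono' (hSm.inter hAm.compl) hfar_pt
      _ ≤ ∫⁻ x in (ball (0 : (EuclideanSpace ℝ (Fin 3))) (2 * ‖y‖))ᶜ, ENNReal.ofReal (64 * M₃ * ‖y‖ * ‖x‖ ^ (-(4 : ℝ))) := by
          refine lintegral_mono_set fun x hx => ?_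
          rw [mem_compl_iff, mem_ball_zero_iff, not_lt]
          exact hx.1
      _ = ENNReal.ofReal (64 * M₃ * ‖y‖) * ∫⁻ x in (ball (0 : (EuclideanSpace ℝ (Fin 3))) (2 * ‖y‖))ᶜ, ENNReal.ofReal (‖x‖ ^ (-(4 : ℝ))) := by
          rw [← lintegral_const_mul' _ _ ENNReal.ofReal_ne_top]
          refine lintegral_congr fun x => ?_
          rw [← ENNReal.ofReal_mul (by positivity)]
      _ = ENNReal.ofReal (64 * M₃ * ‖y‖) * ENNReal.ofReal (3 * v₁ * ((2 * ‖y‖) ^ (3 - (4 : ℝ)) / (4 - 3))) := by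
          rw [NewtonPotentialHolder.lintegral_compl_ball_norm_rpow_neg (by norm_num) (by positivity)]
      _ = ENNReal.ofReal (96 * M₃ * v₁) := by
          rw [← ENNReal.ofReal_mul (by positivity)]
          congr 1
          rw [show (3 : ℝ) - 4 = -1 by norm_num, Real.rpow_neg_one]
          field_simp
          ring
  /- conclusion -/
  calc ∫⁻ x in S, ‖k (x - y) - k x‖ₑ = ∫⁻ x in S ∩ A ∪ S ∩ Aᶜ, ‖k (x - y) - k x‖ₑ := by
        rw [inter_union_compl]
    _ ≤ (∫⁻ x in S ∩ A, ‖k (x - y) - k x‖ₑ) + ∫⁻ x in S ∩ Aᶜ, ‖k (x - y) - k x‖ₑ :=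
        lintegral_union_le _ _ _
    _ ≤ ENNReal.ofReal (64 * M) * V₁ + ENNReal.ofReal (96 * M₃ * v₁) := add_le_add hnear hfar
    _ = Btot := by rw [hBtot]

end KernelRegularity

/-! ## §2. The uniform `L^p` bound for the Hessian convolutions -/

section HessConvLp

/-- **`L^p` bound for the regularised Hessian convolutions, uniform in the scale** (Stein
1970, Ch. II §3.2 Theorem 2 / §4.2 Theorem 3 (a), for the kernels `k^a_ε = ∂ₐ∂ₐΦ_ε`): for
`1 < p < ∞` there is `C` with `‖H^a_ε[h]‖_p ≤ C ‖h‖_p` for all `ε > 0`, `|a| ≤ 2` and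
`h ∈ C_c(ℝ³)` (the uniform Calderón–Zygmund theorem `SingularIntegrals.exists_eLpNorm_le` with
the `L²` bound `eLpNorm_hessConv_le` and the Hörmander bound of §1). [cite: Stein1971, Ch. II §4.2 Thm 3] -/
theorem exists_eLpNorm_hessConv_le {p : ℝ≥0∞} (hp1 : 1 < p) (hp2 : p < ⊤) :
    ∃ C : ℝ≥0, ∀ ε : ℝ, 0 < ε → ∀ a : (EuclideanSpace ℝ (Fin 3)), ‖a‖ ≤ 2 → ∀ h : (EuclideanSpace ℝ (Fin 3)) → ℝ, Continuous h →
      HasCompactSupport h → eLpNorm (hessConv ε h a) p volume ≤ C * eLpNorm h p volume := by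
  obtain ⟨M, hM0, hM⟩ := exists_bound_fderiv_fderiv_newtonReg
  obtain ⟨B, hB⟩ := exists_hormander_bound_hessKernel
  set A₀ : ℝ≥0 := (4 * regLaplacianMass).toNNReal with hA₀
  obtain ⟨C, hC⟩ := SingularIntegrals.exists_eLpNorm_le.{0} 3 A₀ B hp1 hp2
  refine ⟨C, fun ε hε a ha h hh hhc => ?_⟩
  have ha2 : ‖a‖ ^ 2 ≤ 4 := by nlinarith [norm_nonneg a]
  -- the kernel `k^a_ε`, its measurability and sup bound
  have hkm : Measurable fun z : (EuclideanSpace ℝ (Fin 3)) => fderiv ℝ (fun s => fderiv ℝ (newtonReg ε) s a) z a :=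
    (continuous_hessKernel ε a).measurable
  have hkb : ∃ M' : ℝ, ∀ z : (EuclideanSpace ℝ (Fin 3)), |fderiv ℝ (fun s => fderiv ℝ (newtonReg ε) s a) z a| ≤ M' :=
    ⟨ε⁻¹ ^ 3 * M * ‖a‖ ^ 2, fun z => abs_hessKernel_le hM hε a z⟩
  -- the `L²` bound on continuous compactly supported functions
  have hL2 : ∀ g : (EuclideanSpace ℝ (Fin 3)) → ℝ, Continuous g → HasCompactSupport g →
      eLpNorm (fun x => ∫ t, g t * fderiv ℝ (fun s => fderiv ℝ (newtonReg ε) s a) (x - t) a) 2 volume ≤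
        A₀ * eLpNorm g 2 volume := by
    intro g hg hgc
    have hA₀' : (A₀ : ℝ≥0∞) = ENNReal.ofReal (4 * regLaplacianMass) := rfl
    calc eLpNorm (fun x => ∫ t, g t * fderiv ℝ (fun s => fderiv ℝ (newtonReg ε) s a) (x - t) a) 2 volume
        = eLpNorm (hessConv ε g a) 2 volume := rfl
      _ ≤ ENNReal.ofReal (‖a‖ ^ 2) * (ENNReal.ofReal regLaplacianMass * eLpNorm g 2 volume) :=
          eLpNorm_hessConv_le hε hg hgc a
      _ = ENNReal.ofReal (‖a‖ ^ 2 * regLaplacianMass) * eLpNorm g 2 volume := by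
          rw [ENNReal.ofReal_mul (by positivity), mul_assoc]
      _ ≤ A₀ * eLpNorm g 2 volume := by
          rw [hA₀']
          gcongr
          exact regLaplacianMass_nonneg
  -- a sup bound for `h`
  have hhb : ∃ C' : ℝ, ∀ x, |h x| ≤ C' := by
    obtain ⟨C', hC'⟩ := hh.bounded_above_of_compact_support hhc
    exact ⟨C', fun x => by rw [← Real.norm_eq_abs]; exact hC' x⟩
  exact hC (E := (EuclideanSpace ℝ (Fin 3))) volume finrank_euclideanSpace_fin hkm hkb hL2 (hB ε hε a ha) h hh.measurable hhb hhc

end HessConvLp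

/-! ## §3. Polarisation and Fatou -/

section Assembly

variable {w : (EuclideanSpace ℝ (Fin 3)) → (EuclideanSpace ℝ (Fin 3))}

/-- **`L^p` bound for the regularised pressure, uniform in the scale:** for `1 < p < ∞` there
is `C` with `‖Q_ε[w]‖_p ≤ C ‖|w|²‖_p` for all `ε > 0` and `w ∈ C_c(ℝ³; ℝ³)` (polarisation
`Q_ε = -½Σᵢⱼ(H^{bᵢ+bⱼ} - H^{bᵢ} - H^{bⱼ})[wᵢwⱼ]`, `|wᵢwⱼ| ≤ |w|²`, §2 with `|bᵢ + bⱼ| ≤ 2`). [cite: Stein1971, Ch. II §4.2 Thm 3] -/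
theorem exists_eLpNorm_regPressure_le {p : ℝ≥0∞} (hp1 : 1 < p) (hp2 : p < ⊤) :
    ∃ C : ℝ≥0, ∀ ε : ℝ, 0 < ε → ∀ w : (EuclideanSpace ℝ (Fin 3)) → (EuclideanSpace ℝ (Fin 3)), Continuous w → HasCompactSupport w →
      eLpNorm (regPressure ε w) p volume ≤ C * eLpNorm (fun y => ‖w y‖ ^ 2) p volume := by
  obtain ⟨C, hC⟩ := exists_eLpNorm_hessConv_le hp1 hp2
  refine ⟨27 * C, fun ε hε w hw hwc => ?_⟩
  have hp1' : 1 ≤ p := hp1.le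
  set b := stdOrthonormalBasis ℝ (EuclideanSpace ℝ (Fin 3))
  set N : ℝ≥0∞ := eLpNorm (fun y => ‖w y‖ ^ 2) p volume with hN
  have hfun : regPressure ε w = -((2⁻¹ : ℝ) • fun x => ∑ i, ∑ j,
      (hessConv ε (coordProd w i j) (b i + b j) x - hessConv ε (coordProd w i j) (b i) x -
        hessConv ε (coordProd w i j) (b j) x)) := by
    funext x
    simp only [Pi.neg_apply, Pi.smul_apply, smul_eq_mul]
    exact regPressure_eq_sum_hessConv ε hw hwc x
  -- the `L^p` norm of each `wᵢwⱼ` is at most that of `|w|²`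
  have hcp : ∀ i j, eLpNorm (coordProd w i j) p volume ≤ N := fun i j =>
    eLpNorm_mono_real fun y => by
      rw [Real.norm_eq_abs]
      exact abs_coordProd_le w i j y
  -- norms of the directions
  have hb1 : ∀ i, ‖b i‖ ≤ 2 := fun i => by rw [b.orthonormal.1]; norm_num
  have hb2 : ∀ i j, ‖b i + b j‖ ≤ 2 := fun i j =>
    (norm_add_le _ _).trans (by rw [b.orthonormal.1, b.orthonormal.1]; norm_num)
  -- each Hessian convolution
  have hH : ∀ (i j) (u : (EuclideanSpace ℝ (Fin 3))), ‖u‖ ≤ 2 → eLpNorm (hessConv ε (coordProd w i j) u) p volume ≤ C * N :=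
    fun i j u hu => (hC ε hε u hu (coordProd w i j) (continuous_coordProd hw i j)
      (hasCompactSupport_coordProd hwc i j)).trans (by gcongr; exact hcp i j)
  have hm : ∀ (i j) (u : (EuclideanSpace ℝ (Fin 3))), AEStronglyMeasurable (hessConv ε (coordProd w i j) u) volume :=
    fun i j u => aestronglyMeasurable_hessConv ε (continuous_coordProd hw i j) u
  -- each `(i, j)` term
  have hterm : ∀ i j, eLpNorm (fun x => hessConv ε (coordProd w i j) (b i + b j) x -
      hessConv ε (coordProd w i j) (b i) x - hessConv ε (coordProd w i j) (b j) x) p volume ≤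
      3 * (C * N) := by
    intro i j
    calc eLpNorm (fun x => hessConv ε (coordProd w i j) (b i + b j) x -
          hessConv ε (coordProd w i j) (b i) x - hessConv ε (coordProd w i j) (b j) x) p volume
        ≤ eLpNorm (fun x => hessConv ε (coordProd w i j) (b i + b j) x -
            hessConv ε (coordProd w i j) (b i) x) p volume +
            eLpNorm (hessConv ε (coordProd w i j) (b j)) p volume :=
          eLpNorm_sub_le ((hm i j _).sub (hm i j _)) (hm i j _) hp1'
      _ ≤ (eLpNorm (hessConv ε (coordProd w i j) (b i + b j)) p volume +
            eLpNorm (hessConv ε (coordProd w i j) (b i)) p volume) +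
            eLpNorm (hessConv ε (coordProd w i j) (b j)) p volume := by
          gcongr
          exact eLpNorm_sub_le (hm i j _) (hm i j _) hp1'
      _ ≤ (C * N + C * N) + C * N := by
          gcongr
          · exact hH i j _ (hb2 i j)
          · exact hH i j _ (hb1 i)
          · exact hH i j _ (hb1 j)
      _ = 3 * (C * N) := by ring
  -- sum and constants
  rw [hfun, eLpNorm_neg, eLpNorm_const_smul]
  have hsum : eLpNorm (∑ i, ∑ j, fun x => hessConv ε (coordProd w i j) (b i + b j) x -
      hessConv ε (coordProd w i j) (b i) x - hessConv ε (coordProd w i j) (b j) x) p volume ≤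
      (9 : ℕ) • (3 * (C * N)) := by
    calc eLpNorm (∑ i, ∑ j, fun x => hessConv ε (coordProd w i j) (b i + b j) x -
          hessConv ε (coordProd w i j) (b i) x - hessConv ε (coordProd w i j) (b j) x) p volume
        ≤ ∑ i, eLpNorm (∑ j, fun x => hessConv ε (coordProd w i j) (b i + b j) x -
            hessConv ε (coordProd w i j) (b i) x - hessConv ε (coordProd w i j) (b j) x) p volume :=
          eLpNorm_sum_le (fun i _ => Finset.aestronglyMeasurable_sum _ fun j _ =>
            ((hm i j _).sub (hm i j _)).sub (hm i j _)) hp1'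
      _ ≤ ∑ i, ∑ j, eLpNorm (fun x => hessConv ε (coordProd w i j) (b i + b j) x -
            hessConv ε (coordProd w i j) (b i) x - hessConv ε (coordProd w i j) (b j) x) p volume :=
          Finset.sum_le_sum fun i _ => eLpNorm_sum_le (fun j _ =>
            ((hm i j _).sub (hm i j _)).sub (hm i j _)) hp1'
      _ ≤ ∑ _i : Fin (Module.finrank ℝ (EuclideanSpace ℝ (Fin 3))), ∑ _j : Fin (Module.finrank ℝ (EuclideanSpace ℝ (Fin 3))), 3 * (C * N) :=
          Finset.sum_le_sum fun i _ => Finset.sum_le_sum fun j _ => hterm i j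
      _ = (9 : ℕ) • (3 * (C * N)) := by
          rw [Finset.sum_const, Finset.sum_const, Finset.card_univ, Fintype.card_fin,
            finrank_euclideanSpace_fin, smul_smul]
          rfl
  have hfun2 : (∑ i, ∑ j, fun x => hessConv ε (coordProd w i j) (b i + b j) x -
      hessConv ε (coordProd w i j) (b i) x - hessConv ε (coordProd w i j) (b j) x) =
      fun x => ∑ i, ∑ j, (hessConv ε (coordProd w i j) (b i + b j) x -
        hessConv ε (coordProd w i j) (b i) x - hessConv ε (coordProd w i j) (b j) x) := by
    funext x
    simp only [Finset.sum_apply]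
  rw [hfun2] at hsum
  have h2 : ‖(2⁻¹ : ℝ)‖ₑ ≤ 1 := by
    rw [Real.enorm_eq_ofReal (by norm_num)]
    exact ENNReal.ofReal_le_one.2 (by norm_num)
  calc ‖(2⁻¹ : ℝ)‖ₑ * eLpNorm (fun x => ∑ i, ∑ j, (hessConv ε (coordProd w i j) (b i + b j) x -
        hessConv ε (coordProd w i j) (b i) x - hessConv ε (coordProd w i j) (b j) x)) p volume
      ≤ 1 * ((9 : ℕ) • (3 * (C * N))) := mul_le_mul' h2 hsum
    _ = ((27 * C : ℝ≥0) : ℝ≥0∞) * N := by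
        rw [one_mul, nsmul_eq_mul]
        push_cast
        ring

/-- **Discharge of `stein1970_normalisedPressure_Lp_bound`** (Stein 1970, Ch. II §4.2 Theorem 3
for the Riesz-type kernels of the normalised pressure, `1 < p < ∞`): for every `1 < p < ∞`
there is `C = C(p)` with `‖p̃[w]‖_{L^p} ≤ C ‖|w|²‖_{L^p}` for all `w ∈ C^∞_c(ℝ³; ℝ³)`
(`p̃[w] = lim_ε Q_ε[w]` pointwise, the uniform bound for `Q_ε[w]`, Fatou). Proved by
Calderón–Zygmund theory (`Literature/Analysis/SingularIntegrals/`). [cite: Stein1971, Ch. II §4.2 Thm 3] -/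
theorem stein1970_normalisedPressure_Lp_bound_holds : stein1970_normalisedPressure_Lp_bound := by
  intro p hp1 hp2
  obtain ⟨C, hC⟩ := exists_eLpNorm_regPressure_le hp1 hp2
  refine ⟨C, fun w hw hwc => ?_⟩
  have hfun : normalisedPressure w = limPressure w := funext (normalisedPressure_eq_limPressure hw hwc)
  rw [hfun]
  have hFatou := Lp.eLpNorm_lim_le_liminf_eLpNorm (μ := volume) (p := p)
    (f := fun n : ℕ => regPressure (1 / ((n : ℝ) + 1)) w)
    (fun n => aestronglyMeasurable_regPressure (1 / ((n : ℝ) + 1)) hw.continuous hwc)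
    (limPressure w) (Eventually.of_forall fun x => tendsto_regPressure_nat hw hwc x)
  refine hFatou.trans (liminf_le_of_frequently_le' (Eventually.of_forall fun n => ?_).frequently)
  exact hC _ (one_div_pos.2 (Nat.cast_add_one_pos n)) w hw.continuous hwc

end Assembly

end Literature.Analysis.FluidPDE
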